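import Literature.MathematicalPhysics.QuantumFieldTheory.Balaban1983to89.B15Prop1GaugeSectionOfForest

/-!
# `Balaban1983to89.B15Prop1LocalChartFromThm1AtBaseCentral` — [Balaban1985Variational] = «[15]», Thm 1 p. 279, (2) p. 278 (the class on the domains `Ω_j`), (4) p. 278, Prop. 8 p. 305,
# Prop. 9 p. 309; [Balaban1988Convergent] = «[III]», (2.10)–(2.12) p. 256: THE LOCAL-CLASS EDITION of `B15Prop1LocalChartFromThm1AtBase` ∕ `B15Prop1GaugeSectionOfForest` §2 —
# the class letter «`reg'` guarded below `k` everywhere» replaced by its consequence actually used: «the `𝐁`-restricted averages are CONTINUOUS on `reg'`»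

Honest framing: statement-level skeleton of published theorems with citation tags; proofs where landed; nothing here is a claim about the
Yang–Mills mass gap.  Cell `pub-ymgap`, HUMAN RULING D-0149 (width seats), seat `pub-ymgap-dag-n12-w1` (g3; N12 = [B15]; U1a⁺ of the w1 lineage, rule (ii)); `--kind proof
--supports` the K1 item of record; count-neutral; N12 NOT discharged; finite 𝕋⁴ at fixed ε; nothing continuum ∕ ℝ⁴ ∕ OS ∕ mass-gap ∕ Clay.

WHY (two located points on this seat's own g3 files, both repaired here).  (1) CENTRAL, NOT RESIDUAL: the residual form of (T1@q₀) («`∃ u`, `u = 1` at the block towers,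
`U^u = U₀`») is FALSE in general — if the tower-site constraint graph of `𝐁` has two components not linked by a constrained bond and `U₀` is irreducible, `v := −1` on one component,
`+1` on the other preserves the action, the class and EVERY datum on `𝐁` (central values, equal along each constrained bond), so `U₀^v` is a second minimiser on the base fibre, far
from `U₀`, outside its residual orbit (`Stab U₀ = {±1}`).  Print's Thm 1 ([15] p. 279; [III] (2.12) «the minimal orbit, i.e., the set of minima») is uniqueness under the
DATUM-PRESERVING gauge transformations; under (β) these are exactly the tower-CENTRAL ones, and the compactness argument needs from the group only continuity, `A`-invariance and
`D`-invariance for all configurations (§0).  So (T1@q₀) reads «`toMS u j c₋ = toMS u j c₊` commuting with `SU(2)`» in place of «`= 1`»; the section (S) keeps residual `u`.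
(2) LOCAL CLASS LETTER (as in `…Local`): `hDreg' : ContinuousOn (U ↦ (↑(Ū U)_{(j,c)})_{(j,c) ∈ 𝐁}) reg'` instead of the global (0.4) guard, which NODE 00's class ([15] (2) on the
domains `Ω_j`) cannot inhabit.  Everything else is byte-for-byte the g3 argument.

CONTENTS (0 `def`∕`instance`∕`sorry`).  §0 `datum_gaugeAct_of_central`; ★★★ `hcritT_isMinimizer_of_thm1AtBase_central`, `exists_localChart_at_baseField_of_thm1AtBase[_forest]_central`.
HONEST SCOPE: topology ∕ bookkeeping; (T1@q₀), (S)∕forest, (P8), `hcrit`, `honto`, `hnondeg`, the local class letter stay DISPLAYED; nothing of Bałaban's asserted; count-neutral; N12 NOT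
discharged; the YM mass gap (Clay) is NOT proved by any of this — R4 closes only the conditional finite-𝕋⁴ rung `BalabanLadder.UV`.
-/

noncomputable section

namespace Literature.MathematicalPhysics.QuantumFieldTheory.Balaban1983to89.B15Prop1LocalChartFromThm1AtBaseCentral

open Set Metric Filter
open scoped Topology
open Literature.MathematicalPhysics.QuantumFieldTheory.Balaban1983to89.Node00 (SU coeField coeField_apply SmallBelow ConstrSet constrCard constrEnum star_coe_mul_coe_SU)
open B15AveragingHolomorphic (iterMh coeField_iter_eq_iterMh differentiableAt_iterMh)
open B15ComplexifiedDatumFamily (conjVec)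
open B15SU2ChartHolomorphic (expMulC logCoordC differentiableAt_logCoordC)
open B15Prop1StateChartSU2 (differentiable_expMulC_right)
open B15Prop1DatumCoordinates (eventually_smallBelow expMulC_zero_left logCoordC_one)
open B15Prop1ComplexWilsonAction (contDiffAt_actionSum actionSum_expMulC_cplxVec)
open B15Prop1CriticalChartFromIFT (cplxVec_zero)
open B15Prop1ClassOpenAtRecord (isInducing_coeField)
open B15Prop1LocalChartAtBaseField (exists_localChart_at_baseField)
open B15Prop1SliceNondegeneracyFromRealCoercive (analyticAt_sliceAction analyticAt_sliceDatum)
open B15Prop1MinimiserFromBaseUniqueness (htransfer_isMin_of_thm1AtBase)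
open B15Prop1LocalChartFromThm1AtBase (agreeOn_iff_datum_eq continuousAt_datum)
open B15Prop1GaugeSectionOfForest (gaugeSection_of_forest)
open Literature.Analysis.Calculus.ConstrainedCriticalPointLocallyUnique (exists_nhds_critical_unique)
open B14Eq16FaddeevPopov (wilsonAction4_gaugeAct')
open B16Thm1BaseAtRecord11 (continuous_wilsonAction4_SU)
open B12ContinuousTransportInvariance (continuous_gaugeAct_SU)
open B16Sect1Backgrounds (toMS iter_gaugeAct expMul expMul_zero)
open B15Prop1AnalyticExtClause (cplxVec)
open B15Prop1ChartSU2 (su2Chart)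
open ExpMeanLog (expMeanLogSU)
open BlockAveraging (blockAvg)
open T4CubeChartGnomonic (SU2)
open T4Continuum B15DeterminingSets GaugeField
open scoped Matrix.Norms.L2Operator

variable {P : Params}

/-! ## §0  Datum-preserving gauge transformations: CENTRAL values at the block towers of the constrained bonds -/

section Central

variable (𝔹 : DetSet P) (k : ℕ)

/-- **GAUGE TRANSFORMATIONS CENTRAL AT THE BLOCK TOWERS DO NOT MOVE THE DATUM**: if at the block-tower sites of the two endpoints of every constrained bond of levels `≤ k` the gauge
transformation takes ONE value that commutes with every group element (print's residual group (4) has the value `1`; the centre `{±1}` of `SU(2)` is the general datum-preserving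
case), then `Ū^j(U^u)(c) = Ū^j(U)(c)` at every constrained bond (gauge covariance of the averages, [Balaban1985Averaging] (11)). [cite: Balaban1985Variational, (4) p.278; Balaban1985Averaging, (11) p.19] -/
theorem datum_gaugeAct_of_central (hk : k ≤ P.m + P.K) (av : ∀ j, Averaging P j SU2) (u : GaugeTransf P 0 SU2)
    (hu : ∀ j, j ≤ k → ∀ b ∈ bondsOf (𝔹 j), toMS u j b.src = toMS u j b.tgt ∧ ∀ g : SU2, toMS u j b.src * g = g * toMS u j b.src) (U : GaugeField P 0 SU2)
    (i : Fin (constrCard 𝔹 k)) :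
    avgFamily av (gaugeAct u U) ((constrEnum 𝔹 k).symm i).1 ((constrEnum 𝔹 k).symm i).2.1 =
      avgFamily av U ((constrEnum 𝔹 k).symm i).1 ((constrEnum 𝔹 k).symm i).2.1 := by
  set s := (constrEnum 𝔹 k).symm i
  have hj : (s.1 : ℕ) ≤ k := Nat.le_of_lt_succ s.1.2
  obtain ⟨heq, hcomm⟩ := hu s.1 hj s.2.1 s.2.2
  show Averaging.iter av s.1 (gaugeAct u U) s.2.1 = Averaging.iter av s.1 U s.2.1
  rw [iter_gaugeAct av u U s.1 (hj.trans hk)]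
  simp only [GaugeField.gaugeAct]
  rw [← heq, hcomm, mul_inv_cancel_right]

end Central

/-! ## §1  The criticality transfer at `Crit := IsMinimizer`, local class letter, central Theorem-1 letter -/

section Transfer

/-- ★★★ **`hcritT` AT `Crit := IsMinimizer` FROM THEOREM 1 AT THE BASE DATUM.**  In the setting of `exists_localChart_at_baseField` (determining set `𝐁` of levels `≤ k ≤ m + K`, class
`reg`, base datum configuration `Q₀` and base state `U₀` guarded below `k`, `U₀` on the fibre of `Q₀`, conjugation-stable slice `S`, slice action `a` and slice datum coordinates
`Φ₀` characterised pointwise, `hcrit`∕`honto`∕`hnondeg` at `0`, `hclass`), assume the three class facts (`reg'` closed, `closure reg ⊆ reg'`, the `𝐁`-restricted averages continuous on `reg'` — the LOCAL form: NODE 00's class controls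
the configuration only on the domains `Ω_j`, so the global (0.4) guard of `hcritT_isMinimizer_of_thm1AtBase` is not available there) and the
three letters (T1@q₀) THEOREM 1 AT THE BASE DATUM, (S) RESIDUAL GAUGE SECTION near `U₀`, (P8) CHART-CRITICALITY OF MINIMISERS at chart points near `0`.  Then the `hcritT` binder of
`exists_localChart_at_baseField` holds with `Crit Q' U' := IsMinimizer av reg 𝐁 (Ū Q') U'`: a Lagrange-critical slice-chart point near `(0, ↑Q₀)` whose configuration lies on the fibre
of `Q'` IS a minimiser for the datum of `Q'`. [cite: Balaban1985Variational, Thm 1 p.279, (4) p.278, Prop 8 p.305, Sect. F p.300, Prop 9 p.309; Balaban1988Convergent, (2.10)–(2.12) p.256; Balaban1985Averaging, (11) p.19] -/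
theorem hcritT_isMinimizer_of_thm1AtBase_central (𝔹 : DetSet P) (k : ℕ) (hk : k ≤ P.m + P.K) (h𝔹 : ∀ j, k < j → 𝔹 j = ∅) (reg reg' : Set (GaugeField P 0 SU2))
    {Q₀ U₀ : GaugeField P 0 SU2}
    (hsbQ : SmallBelow (fun j => blockAvg (P := P) (j := j) expMeanLogSU) k Q₀)
    (hsbU : SmallBelow (fun j => blockAvg (P := P) (j := j) expMeanLogSU) k U₀)
    (hU₀ : AgreeOn 𝔹 (avgFamily (fun j => blockAvg (P := P) (j := j) expMeanLogSU) U₀) (avgFamily (fun j => blockAvg (P := P) (j := j) expMeanLogSU) Q₀))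
    (S : Submodule ℂ (VecField P 0 (EuclideanSpace ℂ (Fin 3))))
    (a : S → ℂ)
    (ha : ∀ X : S, a X = ∑ p : Plaq P 0, (1 - (expMulC (X : VecField P 0 (EuclideanSpace ℂ (Fin 3))) (coeField U₀) ⟨p.src, p.μ⟩ *
      expMulC (X : VecField P 0 (EuclideanSpace ℂ (Fin 3))) (coeField U₀) ⟨p.src.shift p.μ, p.ν⟩ *
      Matrix.adjugate (expMulC (X : VecField P 0 (EuclideanSpace ℂ (Fin 3))) (coeField U₀) ⟨p.src.shift p.ν, p.μ⟩) *
      Matrix.adjugate (expMulC (X : VecField P 0 (EuclideanSpace ℂ (Fin 3))) (coeField U₀) ⟨p.src, p.ν⟩)).trace / 2))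
    (Φ₀ : S → Fin (constrCard 𝔹 k) → EuclideanSpace ℂ (Fin 3))
    (hΦ₀ : ∀ (X : S) i, Φ₀ X i = logCoordC (star ((avgFamily (fun j => blockAvg (P := P) (j := j) expMeanLogSU) Q₀ ((constrEnum 𝔹 k).symm i).1
      ((constrEnum 𝔹 k).symm i).2.1 : SU2) : Matrix (Fin 2) (Fin 2) ℂ) *
      iterMh ((constrEnum 𝔹 k).symm i).1 (expMulC (X : VecField P 0 (EuclideanSpace ℂ (Fin 3))) (coeField U₀)) ((constrEnum 𝔹 k).symm i).2.1))
    {ℓ₀ : (Fin (constrCard 𝔹 k) → EuclideanSpace ℂ (Fin 3)) →L[ℂ] ℂ}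
    (hcrit : fderiv ℂ a 0 = ℓ₀.comp (fderiv ℂ Φ₀ 0))
    (honto : Function.Surjective (fderiv ℂ Φ₀ 0))
    (hnondeg : ∀ s : S, fderiv ℂ Φ₀ 0 s = 0 →
      (∀ t : S, fderiv ℂ Φ₀ 0 t = 0 → fderiv ℂ (fderiv ℂ a) 0 s t - ℓ₀ (fderiv ℂ (fderiv ℂ Φ₀) 0 s t) = 0) → s = 0)
    (hclass : ∀ᶠ Q in 𝓝 (coeField U₀), ∀ U' : GaugeField P 0 SU2, coeField U' = Q → U' ∈ reg)
    -- the three CLASS facts: the closed-reading class `reg'`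
    (hreg' : IsClosed reg') (hcl : closure reg ⊆ reg')
    -- DISPLAYED (class letter, LOCAL form): the `𝐁`-restricted averages are continuous on the closed-reading class ([15] Prop. 9 on the blocks under the constrained bonds)
    (hDreg' : ContinuousOn (fun (U : GaugeField P 0 SU2) (i : Fin (constrCard 𝔹 k)) =>
      ((avgFamily (fun j => blockAvg (P := P) (j := j) expMeanLogSU) U ((constrEnum 𝔹 k).symm i).1 ((constrEnum 𝔹 k).symm i).2.1 : SU2) :
        Matrix (Fin 2) (Fin 2) ℂ)) reg')
    -- DISPLAYED (T1@q₀): Theorem 1 at the base datum — the DATUM-PRESERVING (central at the 𝐁-towers) orbit of `U₀` is the unique minimal orbit over `reg'`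
    (hT1 : ∀ U ∈ reg', AgreeOn 𝔹 (avgFamily (fun j => blockAvg (P := P) (j := j) expMeanLogSU) U) (avgFamily (fun j => blockAvg (P := P) (j := j) expMeanLogSU) Q₀) →
      wilsonAction4 U ≤ wilsonAction4 U₀ →
        ∃ u : GaugeTransf P 0 SU2, (∀ j, j ≤ k → ∀ b ∈ bondsOf (𝔹 j), toMS u j b.src = toMS u j b.tgt ∧ ∀ g : SU2, toMS u j b.src * g = g * toMS u j b.src) ∧ gaugeAct u U = U₀)
    -- DISPLAYED (S): a residual gauge section near `U₀` into the slice chart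
    (hSec : ∀ 𝒪 ∈ 𝓝 (0 : S), ∀ᶠ U in 𝓝 U₀, ∃ u : GaugeTransf P 0 SU2, (∀ j, j ≤ k → ∀ b ∈ bondsOf (𝔹 j), toMS u j b.src = 1 ∧ toMS u j b.tgt = 1) ∧
      ∃ x ∈ 𝒪, coeField (gaugeAct u U) = expMulC ((x : S) : VecField P 0 (EuclideanSpace ℂ (Fin 3))) (coeField U₀))
    -- DISPLAYED (P8): a minimiser over `reg` at a chart point near `0` is Lagrange-critical in the slice coordinates
    (hP8 : ∀ᶠ x in 𝓝 (0 : S), ∀ U' : GaugeField P 0 SU2, expMulC ((x : S) : VecField P 0 (EuclideanSpace ℂ (Fin 3))) (coeField U₀) = coeField U' →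
      IsMinimizer (fun j => blockAvg (P := P) (j := j) expMeanLogSU) reg 𝔹 (avgFamily (fun j => blockAvg (P := P) (j := j) expMeanLogSU) U') U' →
        ∃ μ : (Fin (constrCard 𝔹 k) → EuclideanSpace ℂ (Fin 3)) →L[ℂ] ℂ, fderiv ℂ a x = μ.comp (fderiv ℂ Φ₀ x)) :
    ∀ᶠ w in 𝓝 ((0 : S), coeField Q₀), ∀ (U' Q' : GaugeField P 0 SU2) (μ : (Fin (constrCard 𝔹 k) → EuclideanSpace ℂ (Fin 3)) →L[ℂ] ℂ),
      expMulC (w.1 : VecField P 0 (EuclideanSpace ℂ (Fin 3))) (coeField U₀) = coeField U' → coeField Q' = w.2 →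
        AgreeOn 𝔹 (avgFamily (fun j => blockAvg (P := P) (j := j) expMeanLogSU) U') (avgFamily (fun j => blockAvg (P := P) (j := j) expMeanLogSU) Q') →
        fderiv ℂ a w.1 = μ.comp (fderiv ℂ Φ₀ w.1) →
          IsMinimizer (fun j => blockAvg (P := P) (j := j) expMeanLogSU) reg 𝔹 (avgFamily (fun j => blockAvg (P := P) (j := j) expMeanLogSU) Q') U' := by
  haveI : CompactSpace (GaugeField P 0 SU2) := inferInstanceAs (CompactSpace (PBond P 0 → SU2))
  -- the objects of the abstract theorem
  set av : ∀ j, Averaging P j SU2 := fun j => blockAvg (P := P) (j := j) expMeanLogSU with hav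
  obtain ⟨D, hD⟩ : ∃ D : GaugeField P 0 SU2 → Fin (constrCard 𝔹 k) → Matrix (Fin 2) (Fin 2) ℂ,
      D = fun U i => ((avgFamily av U ((constrEnum 𝔹 k).symm i).1 ((constrEnum 𝔹 k).symm i).2.1 : SU2) : Matrix (Fin 2) (Fin 2) ℂ) := ⟨_, rfl⟩
  have hDagree : ∀ V W : GaugeField P 0 SU2, AgreeOn 𝔹 (avgFamily av V) (avgFamily av W) ↔ D V = D W := fun V W => by
    rw [hD]; exact agreeOn_iff_datum_eq 𝔹 k h𝔹 _ _
  obtain ⟨Res, hRes⟩ : ∃ Res : Set (GaugeField P 0 SU2 → GaugeField P 0 SU2),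
      Res = {g | ∃ u : GaugeTransf P 0 SU2, (∀ j, j ≤ k → ∀ b ∈ bondsOf (𝔹 j), toMS u j b.src = toMS u j b.tgt ∧ ∀ g : SU2, toMS u j b.src * g = g * toMS u j b.src) ∧ g = gaugeAct u} := ⟨_, rfl⟩
  obtain ⟨AC, hAC⟩ : ∃ AC : (PBond P 0 → Matrix (Fin 2) (Fin 2) ℂ) → ℂ, ∀ W, AC W = ∑ p : Plaq P 0, (1 - (W ⟨p.src, p.μ⟩ * W ⟨p.src.shift p.μ, p.ν⟩ *
      Matrix.adjugate (W ⟨p.src.shift p.ν, p.μ⟩) * Matrix.adjugate (W ⟨p.src, p.ν⟩)).trace / 2) := ⟨_, fun _ => rfl⟩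
  set χ : S → PBond P 0 → Matrix (Fin 2) (Fin 2) ℂ := fun x => expMulC (x : VecField P 0 (EuclideanSpace ℂ (Fin 3))) (coeField U₀) with hχdef
  -- topology of the objects
  have hcoe : Continuous (coeField : GaugeField P 0 SU2 → PBond P 0 → Matrix (Fin 2) (Fin 2) ℂ) := isInducing_coeField.continuous
  have hιinj : Function.Injective (coeField : GaugeField P 0 SU2 → PBond P 0 → Matrix (Fin 2) (Fin 2) ℂ) := fun U V h =>
    funext fun b => Subtype.ext (by simpa only [coeField_apply] using congrFun h b)
  have hA : Continuous (wilsonAction4 : GaugeField P 0 SU2 → ℝ) := continuous_wilsonAction4_SU (N := 2) (P := P) (j := 0)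
  have hDon : ContinuousOn D reg' := by rw [hD]; exact hDreg'
  have hDQ₀ : ContinuousAt D Q₀ := by rw [hD]; exact continuousAt_datum 𝔹 k hsbQ
  have hχc : ContinuousAt χ 0 := ((differentiable_expMulC_right (coeField U₀)).continuous.comp continuous_subtype_val).continuousAt
  have hχ₀ : χ 0 = coeField U₀ := by
    show expMulC ((0 : S) : VecField P 0 (EuclideanSpace ℂ (Fin 3))) (coeField U₀) = coeField U₀
    rw [Submodule.coe_zero, expMulC_zero_left]
  have hÂ : ContinuousAt (fun W => (AC W).re) (coeField U₀) :=
    Complex.continuous_re.continuousAt.comp (contDiffAt_actionSum hAC (coeField U₀) (n := 0)).continuousAt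
  have hÂι : ∀ U : GaugeField P 0 SU2, (AC (coeField U)).re = wilsonAction4 U := fun U => by
    have h := actionSum_expMulC_cplxVec hAC U (0 : VecField P 0 B15Prop1ChartCalculusSU2.E3)
    rw [cplxVec_zero, expMulC_zero_left, expMul_zero] at h
    rw [h, Complex.ofReal_re]
  have hU₀Q₀ : D U₀ = D Q₀ := (hDagree U₀ Q₀).1 hU₀
  have hres : ∀ g ∈ Res, Continuous g ∧ (∀ U, wilsonAction4 (g U) = wilsonAction4 U) ∧ (∀ U, D (g U) = D U) := by
    rintro g hg
    rw [hRes] at hg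
    obtain ⟨u, hu, rfl⟩ := hg
    refine ⟨continuous_gaugeAct_SU (N := 2) (P := P) (j := 0) u, fun U => wilsonAction4_gaugeAct' u U, fun U => ?_⟩
    rw [hD]
    funext i
    exact congrArg (fun g : SU2 => (g : Matrix (Fin 2) (Fin 2) ℂ)) (datum_gaugeAct_of_central 𝔹 k hk av u hu U i)
  -- (T1@q₀) in datum currency
  have hT1' : ∀ U ∈ reg', D U = D U₀ → wilsonAction4 U ≤ wilsonAction4 U₀ → ∃ g ∈ Res, g U = U₀ := by
    intro U hU hDU hAU
    have hagree : AgreeOn 𝔹 (avgFamily av U) (avgFamily av Q₀) := (hDagree U Q₀).2 (hDU.trans hU₀Q₀)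
    obtain ⟨u, hu, huU⟩ := hT1 U hU hagree hAU
    exact ⟨gaugeAct u, by rw [hRes]; exact ⟨u, hu, rfl⟩, huU⟩
  -- (S) in the abstract shape
  have hS' : ∀ 𝒪 ∈ 𝓝 (0 : S), ∀ᶠ U in 𝓝 U₀, ∃ g ∈ Res, ∃ x ∈ 𝒪, coeField (g U) = χ x := by
    intro 𝒪 h𝒪
    filter_upwards [hSec 𝒪 h𝒪] with U hU
    obtain ⟨u, hu, x, hx, hux⟩ := hU
    exact ⟨gaugeAct u, by rw [hRes]; exact ⟨u, fun j hj b hb => ⟨by rw [(hu j hj b hb).1, (hu j hj b hb).2], fun g => by rw [(hu j hj b hb).1, one_mul, mul_one]⟩, rfl⟩, x, hx, hux⟩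
  -- (P8) in the abstract shape
  have hP8' : ∀ᶠ x in 𝓝 (0 : S), ∀ U' : GaugeField P 0 SU2, χ x = coeField U' →
      (U' ∈ reg ∧ ∀ V ∈ reg, D V = D U' → wilsonAction4 U' ≤ wilsonAction4 V) →
        ∃ μ : (Fin (constrCard 𝔹 k) → EuclideanSpace ℂ (Fin 3)) →L[ℂ] ℂ, fderiv ℂ a x = μ.comp (fderiv ℂ Φ₀ x) := by
    filter_upwards [hP8] with x hx U' hχU' hmin
    refine hx U' hχU' ⟨hmin.1, fun j b _ => rfl, fun V hV hVU => hmin.2 V hV ((hDagree V U').1 hVU)⟩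
  -- (U): local uniqueness of chart-critical points, through the logarithmic datum coordinates
  have huniq' : ∃ 𝒪 ∈ 𝓝 (0 : S), ∃ 𝒬 ∈ 𝓝 (D U₀), ∀ (U' U'' : GaugeField P 0 SU2) (x x' : S), x ∈ 𝒪 → x' ∈ 𝒪 → χ x = coeField U' → χ x' = coeField U'' →
      D U' ∈ 𝒬 → D U'' = D U' → (∃ μ : (Fin (constrCard 𝔹 k) → EuclideanSpace ℂ (Fin 3)) →L[ℂ] ℂ, fderiv ℂ a x = μ.comp (fderiv ℂ Φ₀ x)) →
      (∃ μ : (Fin (constrCard 𝔹 k) → EuclideanSpace ℂ (Fin 3)) →L[ℂ] ℂ, fderiv ℂ a x' = μ.comp (fderiv ℂ Φ₀ x')) → x = x' := by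
    -- the generic uniqueness theorem for the analytic Lagrange system `(a, Φ₀)` at `0`
    have ha2 : ContDiffAt ℂ ((1 : WithTop ℕ∞) + 1) a 0 := (analyticAt_sliceAction S ha 0).contDiffAt
    have hΦ2 : ContDiffAt ℂ ((1 : WithTop ℕ∞) + 1) Φ₀ 0 := (analyticAt_sliceDatum S 𝔹 k _ hsbU hU₀ hΦ₀).contDiffAt
    obtain ⟨O, hO, V, hV, huniq⟩ := exists_nhds_critical_unique (𝕜 := ℂ) (m := 1) one_ne_zero ha2 hΦ2 hcrit honto hnondeg
    -- the coordinates as a function of the datum vector: `κ̂ q = (logCoordC (W_i⋆ · q_i))_i`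
    obtain ⟨κ, hκ⟩ : ∃ κ : (Fin (constrCard 𝔹 k) → Matrix (Fin 2) (Fin 2) ℂ) → Fin (constrCard 𝔹 k) → EuclideanSpace ℂ (Fin 3),
        ∀ q i, κ q i = logCoordC (star ((avgFamily av Q₀ ((constrEnum 𝔹 k).symm i).1 ((constrEnum 𝔹 k).symm i).2.1 : SU2) : Matrix (Fin 2) (Fin 2) ℂ) * q i) :=
      ⟨_, fun _ _ => rfl⟩
    -- at a guarded chart point, `Φ₀ x = κ̂ (D U')`
    have hΦD : ∀ (x : S) (U' : GaugeField P 0 SU2), χ x = coeField U' → SmallBelow av k U' → Φ₀ x = κ (D U') := by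
      intro x U' hχU' hsb'
      have hx : expMulC (x : VecField P 0 (EuclideanSpace ℂ (Fin 3))) (coeField U₀) = coeField U' := hχU'
      funext i
      have hj : (((constrEnum 𝔹 k).symm i).1 : ℕ) ≤ k := Nat.le_of_lt_succ ((constrEnum 𝔹 k).symm i).1.2
      have hi : iterMh (((constrEnum 𝔹 k).symm i).1 : ℕ) (coeField U') ((constrEnum 𝔹 k).symm i).2.1 =
          ((avgFamily av U' ((constrEnum 𝔹 k).symm i).1 ((constrEnum 𝔹 k).symm i).2.1 : SU2) : Matrix (Fin 2) (Fin 2) ℂ) := by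
        have h := congrFun (coeField_iter_eq_iterMh (((constrEnum 𝔹 k).symm i).1 : ℕ) (hsb'.mono hj)) ((constrEnum 𝔹 k).symm i).2.1
        rw [coeField_apply] at h
        exact h.symm
      rw [hΦ₀, hκ, hD, hx, hi]
    -- `κ̂` is continuous at the base datum vector and `κ̂ (D U₀) = Φ₀ 0`
    have hκD₀ : κ (D U₀) = Φ₀ 0 := (hΦD 0 U₀ hχ₀ hsbU).symm
    have hκc : ContinuousAt κ (D U₀) := by
      refine continuousAt_pi.2 fun i => ?_
      have hfun : (fun q => κ q i) = fun q : Fin (constrCard 𝔹 k) → Matrix (Fin 2) (Fin 2) ℂ =>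
          logCoordC (star ((avgFamily av Q₀ ((constrEnum 𝔹 k).symm i).1 ((constrEnum 𝔹 k).symm i).2.1 : SU2) : Matrix (Fin 2) (Fin 2) ℂ) * q i) :=
        funext fun q => hκ q i
      rw [hfun]
      have hone : star ((avgFamily av Q₀ ((constrEnum 𝔹 k).symm i).1 ((constrEnum 𝔹 k).symm i).2.1 : SU2) : Matrix (Fin 2) (Fin 2) ℂ) * D U₀ i = 1 := by
        rw [hD]
        show star _ * ((avgFamily av U₀ _ _ : SU2) : Matrix (Fin 2) (Fin 2) ℂ) = 1
        rw [hU₀ _ _ ((constrEnum 𝔹 k).symm i).2.2, star_coe_mul_coe_SU]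
      have hlog : ContinuousAt logCoordC (star ((avgFamily av Q₀ ((constrEnum 𝔹 k).symm i).1 ((constrEnum 𝔹 k).symm i).2.1 : SU2) : Matrix (Fin 2) (Fin 2) ℂ) * D U₀ i) := by
        rw [hone]
        exact (differentiableAt_logCoordC (by rw [sub_self, norm_zero]; exact one_pos)).continuousAt
      have hq : ContinuousAt (fun q : Fin (constrCard 𝔹 k) → Matrix (Fin 2) (Fin 2) ℂ => q i) (D U₀) := (continuous_apply i).continuousAt
      have hmul : ContinuousAt (fun q : Fin (constrCard 𝔹 k) → Matrix (Fin 2) (Fin 2) ℂ =>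
          star ((avgFamily av Q₀ ((constrEnum 𝔹 k).symm i).1 ((constrEnum 𝔹 k).symm i).2.1 : SU2) : Matrix (Fin 2) (Fin 2) ℂ) * q i) (D U₀) :=
        continuousAt_const.mul hq
      exact ContinuousAt.comp_of_eq (g := logCoordC)
        (f := fun q : Fin (constrCard 𝔹 k) → Matrix (Fin 2) (Fin 2) ℂ =>
          star ((avgFamily av Q₀ ((constrEnum 𝔹 k).symm i).1 ((constrEnum 𝔹 k).symm i).2.1 : SU2) : Matrix (Fin 2) (Fin 2) ℂ) * q i) hlog hmul rfl
    have h𝒬 : κ ⁻¹' O ∈ 𝓝 (D U₀) := hκc.preimage_mem_nhds (by rw [hκD₀]; exact hO)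
    -- the guard at chart points near `0`
    have hguard : ∀ᶠ x in 𝓝 (0 : S), ∀ U' : GaugeField P 0 SU2, χ x = coeField U' → SmallBelow av k U' := by
      have h := eventually_smallBelow hsbU
      rw [← hχ₀] at h
      filter_upwards [hχc.eventually h] with x hx U' hU'
      exact hx U' hU'.symm
    refine ⟨V ∩ {x | ∀ U' : GaugeField P 0 SU2, χ x = coeField U' → SmallBelow av k U'}, inter_mem hV hguard, κ ⁻¹' O, h𝒬,
      fun U' U'' x x' hx hx' hχU' hχU'' hDU' hDU'' hc hc' => ?_⟩
    obtain ⟨μ, hμ⟩ := hc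
    obtain ⟨μ', hμ'⟩ := hc'
    have hΦx : Φ₀ x = κ (D U') := hΦD x U' hχU' (hx.2 U' hχU')
    have hΦx' : Φ₀ x' = κ (D U') := by rw [← hDU'']; exact hΦD x' U'' hχU'' (hx'.2 U'' hχU'')
    exact huniq (κ (D U')) hDU' x hx.1 x' hx'.1 μ μ' hμ hΦx hμ' hΦx'
  -- the abstract theorem
  have key := htransfer_isMin_of_thm1AtBase (X := GaugeField P 0 SU2) (reg := reg) (reg' := reg') (Res := Res) (U₀ := U₀) (Q₀ := Q₀)
    (ι := coeField) (χ := χ) (x₀ := 0) (Â := fun W => (AC W).re)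
    (LCrit := fun x : S => ∃ μ : (Fin (constrCard 𝔹 k) → EuclideanSpace ℂ (Fin 3)) →L[ℂ] ℂ, fderiv ℂ a x = μ.comp (fderiv ℂ Φ₀ x))
    (A := wilsonAction4) (D := D) hA hreg' hDon hDQ₀ hcl hres hT1' isInducing_coeField hιinj hχc hχ₀ hÂ hÂι hU₀Q₀ hclass hS' hP8' huniq'
  filter_upwards [key] with w hw U' Q' μ hχU' hQ' hagree hμ
  obtain ⟨hreg, hDU', hmin⟩ := hw U' Q' hχU' hQ' ((hDagree U' Q').1 hagree) ⟨μ, hμ⟩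
  exact ⟨hreg, hagree, fun V hV hVQ => hmin V hV ((hDagree V Q').1 hVQ)⟩


end Transfer

/-! ## §2  The chart theorems, local class letter -/

section Chart

/-- ★★★ **THE LOCAL HOLOMORPHIC MINIMISER CHART AT ONE BASE FIELD FROM THEOREM 1 AT THE BASE DATUM.**  `B15Prop1LocalChartAtBaseField.exists_localChart_at_baseField` with its two
letters `hcritT` ([15] Sect. F at an abstract `Crit`) and `hT1u` ([15] Thm 1's uniqueness clause for ALL nearby data) REPLACED by: the three class facts (`reg'` closed, `closure reg ⊆
reg'`, `𝐁`-averages continuous on `reg'`), (T1@q₀) THEOREM 1 AT THE BASE DATUM (the residual orbit of `U₀` is the unique minimal orbit over `reg'` on the base fibre), (S) a RESIDUAL GAUGE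
SECTION near `U₀` into the slice chart, (P8) [15] Prop. 8 at chart points; plus `k ≤ m + K` (gauge covariance of the averages).  Same conclusion: an open `O ∋ ↑Q₀` and a bounded
holomorphic matrix family `Γ` on `O` whose value at every `SU(2)` datum `Q' ∈ O` is a MINIMISER for the datum of `Q'`.  Proof: `Crit := IsMinimizer`, `hT1u := id`,
`hcritT := hcritT_isMinimizer_of_thm1AtBase`. [cite: Balaban1985Variational, Thm 1 p.279, (4) p.278, Sect. C (47)–(48) p.285, Sect. F p.300, Prop 8 p.305, Sect. G pp.305–307, Prop 9 (190) p.309; Balaban1988Convergent, (2.10)–(2.12) p.256; Balaban1989LargeFieldI, Prop. 1 p.194 (last clause); LuenbergerYe2008, §10.7 pp.306–307] -/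
theorem exists_localChart_at_baseField_of_thm1AtBase_central (𝔹 : DetSet P) (k : ℕ) (hk : k ≤ P.m + P.K) (h𝔹 : ∀ j, k < j → 𝔹 j = ∅) (reg : Set (GaugeField P 0 SU2))
    {Q₀ U₀ : GaugeField P 0 SU2}
    (hsbQ : SmallBelow (fun j => blockAvg (P := P) (j := j) expMeanLogSU) k Q₀)
    (hsbU : SmallBelow (fun j => blockAvg (P := P) (j := j) expMeanLogSU) k U₀)
    (hU₀ : AgreeOn 𝔹 (avgFamily (fun j => blockAvg (P := P) (j := j) expMeanLogSU) U₀) (avgFamily (fun j => blockAvg (P := P) (j := j) expMeanLogSU) Q₀))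
    -- the gauge slice
    (S : Submodule ℂ (VecField P 0 (EuclideanSpace ℂ (Fin 3)))) (hS : ∀ X ∈ S, conjVec X ∈ S)
    -- the action and the constraint coordinates on the slice, characterised pointwise
    (a : S → ℂ)
    (ha : ∀ X : S, a X = ∑ p : Plaq P 0, (1 - (expMulC (X : VecField P 0 (EuclideanSpace ℂ (Fin 3))) (coeField U₀) ⟨p.src, p.μ⟩ *
      expMulC (X : VecField P 0 (EuclideanSpace ℂ (Fin 3))) (coeField U₀) ⟨p.src.shift p.μ, p.ν⟩ *
      Matrix.adjugate (expMulC (X : VecField P 0 (EuclideanSpace ℂ (Fin 3))) (coeField U₀) ⟨p.src.shift p.ν, p.μ⟩) *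
      Matrix.adjugate (expMulC (X : VecField P 0 (EuclideanSpace ℂ (Fin 3))) (coeField U₀) ⟨p.src, p.ν⟩)).trace / 2))
    (Φ₀ : S → Fin (constrCard 𝔹 k) → EuclideanSpace ℂ (Fin 3))
    (hΦ₀ : ∀ (X : S) i, Φ₀ X i = logCoordC (star ((avgFamily (fun j => blockAvg (P := P) (j := j) expMeanLogSU) Q₀ ((constrEnum 𝔹 k).symm i).1
      ((constrEnum 𝔹 k).symm i).2.1 : SU2) : Matrix (Fin 2) (Fin 2) ℂ) *
      iterMh ((constrEnum 𝔹 k).symm i).1 (expMulC (X : VecField P 0 (EuclideanSpace ℂ (Fin 3))) (coeField U₀)) ((constrEnum 𝔹 k).symm i).2.1))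
    -- DISPLAYED: Lagrange criticality of the base state, «onto», (β) nondegeneracy — in these coordinates
    {ℓ₀ : (Fin (constrCard 𝔹 k) → EuclideanSpace ℂ (Fin 3)) →L[ℂ] ℂ}
    (hcrit : fderiv ℂ a 0 = ℓ₀.comp (fderiv ℂ Φ₀ 0))
    (honto : Function.Surjective (fderiv ℂ Φ₀ 0))
    (hnondeg : ∀ s : S, fderiv ℂ Φ₀ 0 s = 0 →
      (∀ t : S, fderiv ℂ Φ₀ 0 t = 0 → fderiv ℂ (fderiv ℂ a) 0 s t - ℓ₀ (fderiv ℂ (fderiv ℂ Φ₀) 0 s t) = 0) → s = 0)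
    -- DISPLAYED: the class is open at `U₀`; criticality transfer; [15] Thm 1's uniqueness clause
    (hclass : ∀ᶠ Q in 𝓝 (coeField U₀), ∀ U' : GaugeField P 0 SU2, coeField U' = Q → U' ∈ reg)
    -- the three CLASS facts: the closed-reading class `reg'`
    (reg' : Set (GaugeField P 0 SU2)) (hreg' : IsClosed reg') (hcl : closure reg ⊆ reg')
    (hDreg' : ContinuousOn (fun (U : GaugeField P 0 SU2) (i : Fin (constrCard 𝔹 k)) =>
      ((avgFamily (fun j => blockAvg (P := P) (j := j) expMeanLogSU) U ((constrEnum 𝔹 k).symm i).1 ((constrEnum 𝔹 k).symm i).2.1 : SU2) :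
        Matrix (Fin 2) (Fin 2) ℂ)) reg')
    -- DISPLAYED (T1@q₀): Theorem 1 at the base datum — the DATUM-PRESERVING (central at the 𝐁-towers) orbit of `U₀` is the unique minimal orbit over `reg'`
    (hT1 : ∀ U ∈ reg', AgreeOn 𝔹 (avgFamily (fun j => blockAvg (P := P) (j := j) expMeanLogSU) U) (avgFamily (fun j => blockAvg (P := P) (j := j) expMeanLogSU) Q₀) →
      wilsonAction4 U ≤ wilsonAction4 U₀ →
        ∃ u : GaugeTransf P 0 SU2, (∀ j, j ≤ k → ∀ b ∈ bondsOf (𝔹 j), toMS u j b.src = toMS u j b.tgt ∧ ∀ g : SU2, toMS u j b.src * g = g * toMS u j b.src) ∧ gaugeAct u U = U₀)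
    -- DISPLAYED (S): a residual gauge section near `U₀` into the slice chart
    (hSec : ∀ 𝒪 ∈ 𝓝 (0 : S), ∀ᶠ U in 𝓝 U₀, ∃ u : GaugeTransf P 0 SU2, (∀ j, j ≤ k → ∀ b ∈ bondsOf (𝔹 j), toMS u j b.src = 1 ∧ toMS u j b.tgt = 1) ∧
      ∃ x ∈ 𝒪, coeField (gaugeAct u U) = expMulC ((x : S) : VecField P 0 (EuclideanSpace ℂ (Fin 3))) (coeField U₀))
    -- DISPLAYED (P8): a minimiser over `reg` at a chart point near `0` is Lagrange-critical in the slice coordinates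
    (hP8 : ∀ᶠ x in 𝓝 (0 : S), ∀ U' : GaugeField P 0 SU2, expMulC ((x : S) : VecField P 0 (EuclideanSpace ℂ (Fin 3))) (coeField U₀) = coeField U' →
      IsMinimizer (fun j => blockAvg (P := P) (j := j) expMeanLogSU) reg 𝔹 (avgFamily (fun j => blockAvg (P := P) (j := j) expMeanLogSU) U') U' →
        ∃ μ : (Fin (constrCard 𝔹 k) → EuclideanSpace ℂ (Fin 3)) →L[ℂ] ℂ, fderiv ℂ a x = μ.comp (fderiv ℂ Φ₀ x))
    {𝓐₀ : ℝ} (h𝓐₀ : 1 < 𝓐₀) :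
    ∃ O : Set (PBond P 0 → Matrix (Fin 2) (Fin 2) ℂ), IsOpen O ∧ coeField Q₀ ∈ O ∧
      ∃ Γ : (PBond P 0 → Matrix (Fin 2) (Fin 2) ℂ) → PBond P 0 → Matrix (Fin 2) (Fin 2) ℂ,
        (∀ b i j, DifferentiableOn ℂ (fun Q => Γ Q b i j) O) ∧
        (∀ Q ∈ O, ∀ b i j, ‖Γ Q b i j‖ ≤ 𝓐₀) ∧
        ∀ Q' : GaugeField P 0 SU2, coeField Q' ∈ O →
          ∃ U' : GaugeField P 0 SU2, (∀ b, Γ (coeField Q') b = ((U' b : SU2) : Matrix (Fin 2) (Fin 2) ℂ)) ∧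
            IsMinimizer (fun j => blockAvg (P := P) (j := j) expMeanLogSU) reg 𝔹 (avgFamily (fun j => blockAvg (P := P) (j := j) expMeanLogSU) Q') U' :=
  exists_localChart_at_baseField 𝔹 k h𝔹 reg hsbQ hsbU hU₀ S hS a ha Φ₀ hΦ₀ hcrit honto hnondeg
    (fun Q' U' => IsMinimizer (fun j => blockAvg (P := P) (j := j) expMeanLogSU) reg 𝔹 (avgFamily (fun j => blockAvg (P := P) (j := j) expMeanLogSU) Q') U')
    hclass
    (hcritT_isMinimizer_of_thm1AtBase_central 𝔹 k hk h𝔹 reg reg' hsbQ hsbU hU₀ S a ha Φ₀ hΦ₀ hcrit honto hnondeg hclass hreg' hcl hDreg' hT1 hSec hP8)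
    (Filter.Eventually.of_forall fun _ _ _ _ _ _ h => h) h𝓐₀


/-- ★★★ **THE LOCAL HOLOMORPHIC MINIMISER CHART AT ONE BASE FIELD, ON THE AXIAL SLICE OF A ROOTED FOREST, FROM THEOREM 1 AT THE BASE DATUM.**
`B15Prop1LocalChartFromThm1AtBase.exists_localChart_at_baseField_of_thm1AtBase` with the slice `S` = the axial slice (F3) of a rooted forest `path` with (F1), (F2) — so that the
conjugation-stability of `S` and the residual gauge section (S) are THEOREMS (`gaugeSection_of_forest`) — leaving displayed, per base field: `hcrit`, `honto`, (β) `hnondeg`, `hclass`,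
the class facts, (T1@q₀) Theorem 1 at the base datum, (P8) Prop. 8 at chart points, and the forest datum (print's comb `Ax_k(𝔅_k, U₀)`, [6] (1.19)). [cite: Balaban1985Variational, Thm 1 p.279, (4) p.278, (16)–(18) p.280, Sect. C (47)–(48) p.285, Sect. F p.300, Prop 8 p.305, Sect. G pp.305–307, Prop 9 (190) p.309; Balaban1985RegularSpaces, (1.19) p.79; Balaban1988Convergent, (2.10)–(2.12) p.256; Balaban1989LargeFieldI, Prop. 1 p.194 (last clause)] -/
theorem exists_localChart_at_baseField_of_thm1AtBase_forest_central (𝔹 : DetSet P) (k : ℕ) (hk : k ≤ P.m + P.K) (h𝔹 : ∀ j, k < j → 𝔹 j = ∅) (reg : Set (GaugeField P 0 SU2))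
    {Q₀ U₀ : GaugeField P 0 SU2}
    (hsbQ : SmallBelow (fun j => blockAvg (P := P) (j := j) expMeanLogSU) k Q₀)
    (hsbU : SmallBelow (fun j => blockAvg (P := P) (j := j) expMeanLogSU) k U₀)
    (hU₀ : AgreeOn 𝔹 (avgFamily (fun j => blockAvg (P := P) (j := j) expMeanLogSU) U₀) (avgFamily (fun j => blockAvg (P := P) (j := j) expMeanLogSU) Q₀))
    -- the gauge slice = the axial slice of a rooted forest (F3), with (F1) prefix∕orientation and (F2) roots at the block towers of the constrained bonds
    (S : Submodule ℂ (VecField P 0 (EuclideanSpace ℂ (Fin 3))))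
    (path : Site P 0 → List (LStep P 0))
    (hF1 : ∀ x, ∀ s ∈ path x, ∃ x' x'' : Site P 0, path x'' = path x' ++ [s] ∧
      (s.fwd = true → s.bond.src = x' ∧ s.bond.tgt = x'') ∧ (s.fwd = false → s.bond.src = x'' ∧ s.bond.tgt = x'))
    (hF2 : ∀ j, j ≤ k → ∀ c ∈ bondsOf (𝔹 j), path (embIter j c.src) = [] ∧ path (embIter j c.tgt) = [])
    (hF3 : ∀ X : VecField P 0 (EuclideanSpace ℂ (Fin 3)), X ∈ S ↔ ∀ x, ∀ s ∈ path x, X s.bond = 0)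
    -- the action and the constraint coordinates on the slice, characterised pointwise
    (a : S → ℂ)
    (ha : ∀ X : S, a X = ∑ p : Plaq P 0, (1 - (expMulC (X : VecField P 0 (EuclideanSpace ℂ (Fin 3))) (coeField U₀) ⟨p.src, p.μ⟩ *
      expMulC (X : VecField P 0 (EuclideanSpace ℂ (Fin 3))) (coeField U₀) ⟨p.src.shift p.μ, p.ν⟩ *
      Matrix.adjugate (expMulC (X : VecField P 0 (EuclideanSpace ℂ (Fin 3))) (coeField U₀) ⟨p.src.shift p.ν, p.μ⟩) *
      Matrix.adjugate (expMulC (X : VecField P 0 (EuclideanSpace ℂ (Fin 3))) (coeField U₀) ⟨p.src, p.ν⟩)).trace / 2))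
    (Φ₀ : S → Fin (constrCard 𝔹 k) → EuclideanSpace ℂ (Fin 3))
    (hΦ₀ : ∀ (X : S) i, Φ₀ X i = logCoordC (star ((avgFamily (fun j => blockAvg (P := P) (j := j) expMeanLogSU) Q₀ ((constrEnum 𝔹 k).symm i).1
      ((constrEnum 𝔹 k).symm i).2.1 : SU2) : Matrix (Fin 2) (Fin 2) ℂ) *
      iterMh ((constrEnum 𝔹 k).symm i).1 (expMulC (X : VecField P 0 (EuclideanSpace ℂ (Fin 3))) (coeField U₀)) ((constrEnum 𝔹 k).symm i).2.1))
    -- DISPLAYED: Lagrange criticality of the base state, «onto», (β) nondegeneracy — in these coordinates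
    {ℓ₀ : (Fin (constrCard 𝔹 k) → EuclideanSpace ℂ (Fin 3)) →L[ℂ] ℂ}
    (hcrit : fderiv ℂ a 0 = ℓ₀.comp (fderiv ℂ Φ₀ 0))
    (honto : Function.Surjective (fderiv ℂ Φ₀ 0))
    (hnondeg : ∀ s : S, fderiv ℂ Φ₀ 0 s = 0 →
      (∀ t : S, fderiv ℂ Φ₀ 0 t = 0 → fderiv ℂ (fderiv ℂ a) 0 s t - ℓ₀ (fderiv ℂ (fderiv ℂ Φ₀) 0 s t) = 0) → s = 0)
    -- DISPLAYED: the class is open at `U₀`; criticality transfer; [15] Thm 1's uniqueness clause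
    (hclass : ∀ᶠ Q in 𝓝 (coeField U₀), ∀ U' : GaugeField P 0 SU2, coeField U' = Q → U' ∈ reg)
    -- the three CLASS facts: the closed-reading class `reg'`
    (reg' : Set (GaugeField P 0 SU2)) (hreg' : IsClosed reg') (hcl : closure reg ⊆ reg')
    (hDreg' : ContinuousOn (fun (U : GaugeField P 0 SU2) (i : Fin (constrCard 𝔹 k)) =>
      ((avgFamily (fun j => blockAvg (P := P) (j := j) expMeanLogSU) U ((constrEnum 𝔹 k).symm i).1 ((constrEnum 𝔹 k).symm i).2.1 : SU2) :
        Matrix (Fin 2) (Fin 2) ℂ)) reg')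
    -- DISPLAYED (T1@q₀): Theorem 1 at the base datum — the DATUM-PRESERVING (central at the 𝐁-towers) orbit of `U₀` is the unique minimal orbit over `reg'`
    (hT1 : ∀ U ∈ reg', AgreeOn 𝔹 (avgFamily (fun j => blockAvg (P := P) (j := j) expMeanLogSU) U) (avgFamily (fun j => blockAvg (P := P) (j := j) expMeanLogSU) Q₀) →
      wilsonAction4 U ≤ wilsonAction4 U₀ →
        ∃ u : GaugeTransf P 0 SU2, (∀ j, j ≤ k → ∀ b ∈ bondsOf (𝔹 j), toMS u j b.src = toMS u j b.tgt ∧ ∀ g : SU2, toMS u j b.src * g = g * toMS u j b.src) ∧ gaugeAct u U = U₀)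
    -- DISPLAYED (P8): a minimiser over `reg` at a chart point near `0` is Lagrange-critical in the slice coordinates
    (hP8 : ∀ᶠ x in 𝓝 (0 : S), ∀ U' : GaugeField P 0 SU2, expMulC ((x : S) : VecField P 0 (EuclideanSpace ℂ (Fin 3))) (coeField U₀) = coeField U' →
      IsMinimizer (fun j => blockAvg (P := P) (j := j) expMeanLogSU) reg 𝔹 (avgFamily (fun j => blockAvg (P := P) (j := j) expMeanLogSU) U') U' →
        ∃ μ : (Fin (constrCard 𝔹 k) → EuclideanSpace ℂ (Fin 3)) →L[ℂ] ℂ, fderiv ℂ a x = μ.comp (fderiv ℂ Φ₀ x))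
    {𝓐₀ : ℝ} (h𝓐₀ : 1 < 𝓐₀) :
    ∃ O : Set (PBond P 0 → Matrix (Fin 2) (Fin 2) ℂ), IsOpen O ∧ coeField Q₀ ∈ O ∧
      ∃ Γ : (PBond P 0 → Matrix (Fin 2) (Fin 2) ℂ) → PBond P 0 → Matrix (Fin 2) (Fin 2) ℂ,
        (∀ b i j, DifferentiableOn ℂ (fun Q => Γ Q b i j) O) ∧
        (∀ Q ∈ O, ∀ b i j, ‖Γ Q b i j‖ ≤ 𝓐₀) ∧
        ∀ Q' : GaugeField P 0 SU2, coeField Q' ∈ O →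
          ∃ U' : GaugeField P 0 SU2, (∀ b, Γ (coeField Q') b = ((U' b : SU2) : Matrix (Fin 2) (Fin 2) ℂ)) ∧
            IsMinimizer (fun j => blockAvg (P := P) (j := j) expMeanLogSU) reg 𝔹 (avgFamily (fun j => blockAvg (P := P) (j := j) expMeanLogSU) Q') U' :=
  exists_localChart_at_baseField_of_thm1AtBase_central 𝔹 k hk h𝔹 reg hsbQ hsbU hU₀ S
    (fun X hX => (hF3 _).2 fun x s hs => by
      have h0 : X s.bond = 0 := (hF3 X).1 hX x s hs
      ext a
      simp [conjVec, h0])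
    a ha Φ₀ hΦ₀ hcrit honto hnondeg hclass reg' hreg' hcl hDreg' hT1 (gaugeSection_of_forest 𝔹 k U₀ S path hF1 hF2 hF3) hP8 h𝓐₀


end Chart

end Literature.MathematicalPhysics.QuantumFieldTheory.Balaban1983to89.B15Prop1LocalChartFromThm1AtBaseCentral

end
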